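import Mathlib
import Summits.QuantumFields.BalabanUV.Beta.UnitLatticeDecoratedPaths
import Summits.QuantumFields.BalabanUV.Beta.AnalyticWalkSum216RowData

/-!
# `Summit.QuantumFields.BalabanUV.Beta.UnitLatticeDecoratedRowData` — A3-loc (iv) HAND-OFF: the s-decorated unit-lattice
# walk expansion, ONE FREE COORDINATE `s(Δ₀) = σ` at a time (the others frozen on `‖τ(Δ)‖ ≤ e^{κ₁}`), IS an
# `AnalyticWalkSum216RowData.RowData` family (the row-D4 owner's volume-free currency) on the disc `‖σ‖ < e^{κ₁}`, with
# majorant `e^{κ₁c₀}·walkMajP` and constant `e^{κ₁c₀}·N·C_L′/(1 − ρ′)`; at `s ≡ 1` its sum is `(1 + K′)⁻¹`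

HONEST FRAMING (page 1 of everything in this cell).  Discharging `FlowStep.BetaPertH` would make Bałaban's ultraviolet
stability UNCONDITIONAL — a constructive-QFT result; NOT the continuum limit, NOT the Clay problem.  This module
discharges nothing of `BetaPertH`; [folklore] bookkeeping, kernel-checked (unit `b2b-balaban-beta-d4-p3`, road P3, gen 4;
the hand-off asked for by the row owner an4-g37, journal l.9554 ∕ l.10048 ∕ l.10196: «d4-p3's summed majorants (one free
coordinate s(Δ) at a time) are the hand-off data BY NAME», decoration radius `r = e^{κ₁}` an explicit letter).
HONEST DEPENDENCY: continuum YM on T⁴ ⇐ BetaPertH ∧ nine spine estimates (0/9 proved); BetaPertH ⇐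
(D1) ∧ (D4) ∧ CAP+tail; G-an2-4 gates asym, D1 and NE2/3/4.

CONTENTS (0 sorry).  §1 `decCoeffAt τ Δ₀ … σ` (the decoration monomial with the coordinate `Δ₀` set to `σ`): entire in
`σ`, `‖·‖ ≤ r^{#dec}` on `‖σ‖ ≤ r` when `‖τ‖ ≤ r`, `= 1` at `τ ≡ 1, σ = 1`.  §2 the family `decFamily` on the index type
`Walk B = Σ n, (Fin (n+1) → B)` (ALL orders) and its majorant `decMaj A₀ δ = A₀·walkMajP δ`; `norm_coeff_mul_walkTerm_le`
(the termwise bound of `UnitLatticeDecoratedPaths`, exposed).  §3 fibre sums `sum_walkMajP_apply_le` (≤ N·C_L′·ρ′ⁿ),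
`summable_decMaj`, `row_majSum_decMaj_le` (≤ A₀·N·C_L′/(1 − ρ′)).  §4 **`rowData_decFamily`** (tube property in the path
currency in, `RowData` out) and **`rowData_decFamily_tube`** (the concrete decoration `tubeDec cellOf E` under packing:
`c₀ = P`, slope `P/r`).  §5 **`termSum_decFamily_one`**: at `s ≡ 1` the summed family is `(1 + K′)⁻¹`
(`AnalyticWalkSum216Neumann.hasSum_pow_apply` + `UnitLatticeWalkInversion.inv_one_add_eq` BY NAME).
NOT HERE: the near∕far refinement (ii) inside the terms (U-localisation of each factor), any instance on Bałaban's
operators; (T3) and NODE O.2 untouched.  NOT summit progress.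
-/

open scoped BigOperators Matrix
open Finset Matrix Metric

namespace Summit.QuantumFields.BalabanUV.Beta.UnitLatticeDecoratedRowData

open Summit.QuantumFields.BalabanUV.Beta.UnitLatticeWalkInversion
open Summit.QuantumFields.BalabanUV.Beta.UnitLatticeWalkTerms
open Summit.QuantumFields.BalabanUV.Beta.UnitLatticeDecoratedResolvent (decCoeff)
open Summit.QuantumFields.BalabanUV.Beta.UnitLatticeTubeCount (pathLen tubeDec card_tubeDec_le)
open Summit.QuantumFields.BalabanUV.Beta.UnitLatticeDecoratedPaths
open Summit.QuantumFields.BalabanUV.Beta.AnalyticWalkSum216 (termSum majSum)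
open Summit.QuantumFields.BalabanUV.Beta.AnalyticWalkSum216RowData (RowData)
open Summit.QuantumFields.BalabanUV.Beta.AnalyticWalkSum216Neumann (hasSum_pow_apply)
open Literature.MathematicalPhysics.QuantumFieldTheory.Balaban1983to89.B13PerturbativeStep (wrs WRS WeightHyp)

noncomputable section

variable {Y : Type*} [Fintype Y] [DecidableEq Y] {B : Type*} {Δ : Type*} [DecidableEq Δ]

/-- The index type of the walk expansion to ALL orders: a length `n` and a cube sequence `b⃗ : Fin (n+1) → B`. [folklore] -/
abbrev Walk (B : Type*) := Σ n : ℕ, (Fin (n + 1) → B)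

/-! ## §1 The decoration monomial with one coordinate free -/

/-- `decCoeffAt τ Δ₀ dec n b⃗ σ := Π_{Δ ∈ dec(b⃗)} s(Δ)` with `s = τ` except `s(Δ₀) = σ`. [folklore] -/
def decCoeffAt (τ : Δ → ℂ) (Δ₀ : Δ) (dec : (n : ℕ) → (Fin (n + 1) → B) → Finset Δ) (n : ℕ) (b : Fin (n + 1) → B)
    (σ : ℂ) : ℂ :=
  decCoeff (Function.update τ Δ₀ σ) dec n b

omit [Fintype Y] [DecidableEq Y] in
/-- `σ ↦ decCoeffAt … σ` is complex-differentiable on every set (a finite product of `σ` and constants). [folklore] -/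
theorem differentiableOn_decCoeffAt (τ : Δ → ℂ) (Δ₀ : Δ) (dec : (n : ℕ) → (Fin (n + 1) → B) → Finset Δ) (n : ℕ)
    (b : Fin (n + 1) → B) (U : Set ℂ) : DifferentiableOn ℂ (fun σ => decCoeffAt τ Δ₀ dec n b σ) U := by
  unfold decCoeffAt decCoeff
  refine DifferentiableOn.fun_finsetProd fun δ _ => ?_
  by_cases hδ : δ = Δ₀
  · subst hδ
    simp only [Function.update_self]
    exact differentiableOn_id
  · simp only [Function.update_of_ne hδ]
    exact differentiableOn_const _

omit [Fintype Y] [DecidableEq Y] in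
/-- On `‖σ‖ ≤ r` with `‖τ(Δ)‖ ≤ r`: `‖decCoeffAt … σ‖ ≤ r^{#dec(b⃗)}`. [folklore] -/
theorem norm_decCoeffAt_le {τ : Δ → ℂ} {r : ℝ} (hτ : ∀ δ, ‖τ δ‖ ≤ r) (Δ₀ : Δ)
    (dec : (n : ℕ) → (Fin (n + 1) → B) → Finset Δ) (n : ℕ) (b : Fin (n + 1) → B) {σ : ℂ} (hσ : ‖σ‖ ≤ r) :
    ‖decCoeffAt τ Δ₀ dec n b σ‖ ≤ r ^ (dec n b).card := by
  unfold decCoeffAt decCoeff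
  rw [norm_prod, ← Finset.prod_const]
  exact Finset.prod_le_prod (fun _ _ => norm_nonneg _) fun δ _ => by
    by_cases hδ : δ = Δ₀
    · subst hδ
      rwa [Function.update_self]
    · rw [Function.update_of_ne hδ]
      exact hτ δ

omit [Fintype Y] [DecidableEq Y] in
/-- At `τ ≡ 1`, `σ = 1` the coefficient is `1`. [folklore] -/
theorem decCoeffAt_one (Δ₀ : Δ) (dec : (n : ℕ) → (Fin (n + 1) → B) → Finset Δ) (n : ℕ) (b : Fin (n + 1) → B) :
    decCoeffAt (fun _ => (1 : ℂ)) Δ₀ dec n b 1 = 1 := by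
  unfold decCoeffAt decCoeff
  rw [Function.update_eq_self_iff.2 rfl]
  exact Finset.prod_const_one

/-! ## §2 The family and its majorant -/

/-- THE DECORATED FAMILY with the coordinate `Δ₀` free: `w = (n, b⃗) ↦ (σ ↦ decCoeffAt τ Δ₀ (b⃗) σ • walkTerm n b⃗)`. [folklore] -/
def decFamily (h : B → Y → ℝ) (K' : Matrix Y Y ℂ) (L : B → Matrix Y Y ℂ)
    (dec : (n : ℕ) → (Fin (n + 1) → B) → Finset Δ) (τ : Δ → ℂ) (Δ₀ : Δ) : Walk B → ℂ → Matrix Y Y ℂ :=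
  fun w σ => decCoeffAt τ Δ₀ dec w.1 w.2 σ • walkTerm h K' L w.1 w.2

/-- ITS MAJORANT: `A₀·walkMajP δ n b⃗` (credit on every link, `UnitLatticeDecoratedPaths`). [folklore] -/
def decMaj (A₀ δ : ℝ) (d : Y → Y → ℝ) (h : B → Y → ℝ) (K' : Matrix Y Y ℂ) (L : B → Matrix Y Y ℂ) :
    Walk B → Y → Y → ℝ :=
  fun w i j => A₀ * walkMajP δ d h K' L w.1 w.2 i j

/-- **THE TERMWISE BOUND** (the heart of `UnitLatticeDecoratedPaths.wrs_decoratedSum_path`, exposed): if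
`‖c‖ ≤ A₀·e^{δ·pathLen(y)}` for every admissible chain `y` of `b⃗`, then `‖c‖·‖walkTerm n b⃗ (i,j)‖ ≤ A₀·walkMajP δ n b⃗ (i,j)`
(a shortest admissible chain ending at `j` exists whenever the entry is nonzero). [folklore] -/
theorem norm_coeff_mul_walkTerm_le (h : B → Y → ℝ) (E : B → Finset Y) (hsupp : ∀ b y, y ∉ E b → h b y = 0)
    (K' : Matrix Y Y ℂ) (L : B → Matrix Y Y ℂ) {δ : ℝ} (hδ : 0 ≤ δ) (d : Y → Y → ℝ) (hd0 : ∀ a c, 0 ≤ d a c)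
    (htri : ∀ a c e, d a e ≤ d a c + d c e) {A₀ : ℝ} (hA₀ : 0 ≤ A₀) (n : ℕ) (b : Fin (n + 1) → B) (c : ℂ)
    (hc : ∀ y : Fin (n + 1) → Y, (∀ t, y t ∈ E (b t)) → ‖c‖ ≤ A₀ * Real.exp (δ * pathLen d n y)) (i j : Y) :
    ‖c‖ * ‖walkTerm h K' L n b i j‖ ≤ A₀ * walkMajP δ d h K' L n b i j := by
  classical
  by_cases hne : walkTerm h K' L n b i j = 0
  · rw [hne, norm_zero, mul_zero]
    exact mul_nonneg hA₀ (walkMajP_nonneg δ d h K' L n b i j)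
  · set S := (Finset.univ : Finset (Fin (n + 1) → Y)).filter fun y => (∀ t, y t ∈ E (b t)) ∧ y (Fin.last n) = j
      with hS
    have hSne : S.Nonempty := by
      obtain ⟨y, hy, hyj⟩ := exists_chain_of_walkTerm_ne_zero h E hsupp K' L n b i j hne
      exact ⟨y, Finset.mem_filter.2 ⟨Finset.mem_univ _, hy, hyj⟩⟩
    obtain ⟨y₀, hy₀, hmin⟩ := Finset.exists_min_image S (pathLen d n) hSne
    have hy₀' := (Finset.mem_filter.1 hy₀).2
    have h1 := norm_walkTerm_le_walkMajP h E hsupp K' L hδ d hd0 htri n b i j _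
      (fun y hy hyj => hmin y (Finset.mem_filter.2 ⟨Finset.mem_univ _, hy, hyj⟩))
    calc ‖c‖ * ‖walkTerm h K' L n b i j‖
        ≤ A₀ * Real.exp (δ * pathLen d n y₀) * ‖walkTerm h K' L n b i j‖ :=
          mul_le_mul_of_nonneg_right (hc y₀ hy₀'.1) (norm_nonneg _)
      _ = A₀ * (Real.exp (δ * pathLen d n y₀) * ‖walkTerm h K' L n b i j‖) := by ring
      _ ≤ A₀ * walkMajP δ d h K' L n b i j := mul_le_mul_of_nonneg_left h1 hA₀

/-! ## §3 Fibre sums and summability -/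

section Wrs

variable {κ : ℝ} {d : Y → Y → ℝ}

/-- **Fibre sums of the majorant**: `Σ_{b⃗ : Fin (n+1) → B} walkMajP δ n b⃗ (i,j) ≤ N·C_L′·((2N/M)·C_L′·K₁′)ⁿ` (entry ≤ weighted
row sum of `headMajPSum·stepMajPSumⁿ`). [folklore] -/
theorem sum_walkMajP_apply_le [Fintype B] (hw : WeightHyp κ d) {δ : ℝ} (K' : Matrix Y Y ℂ) (h : B → Y → ℝ)
    (E : B → Finset Y) (L : B → Matrix Y Y ℂ) (hsupp : ∀ b y, y ∉ E b → h b y = 0) (habs : ∀ b y, |h b y| ≤ 1)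
    {M N C_L K₁ : ℝ} (hM : 0 < M) (hLip : ∀ b y y', |h b y - h b y'| ≤ d y y' / M)
    (hN : ∀ y, ((Finset.univ.filter fun b => y ∈ E b).card : ℝ) ≤ N) (hC : 0 ≤ C_L)
    (hL : ∀ b, WRS (κ + δ) d (L b) C_L) (hK₁ : ∀ i, ∑ j, ‖K' i j‖ * d i j * Real.exp ((κ + δ) * d i j) ≤ K₁)
    (n : ℕ) (i j : Y) :
    ∑ b : Fin (n + 1) → B, walkMajP δ d h K' L n b i j ≤ N * C_L * (2 * N / M * C_L * K₁) ^ n := by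
  have hPR : WRS κ d (headMajPSum δ d h L * stepMajPSum δ d h K' L ^ n) ((N * C_L) * (2 * N / M * C_L * K₁) ^ n) :=
    (wrs_headMajPSum h E L hsupp habs hC hN hL).mul hw
      ((wrs_stepMajPSum hw K' h E L hsupp habs hM hLip hN hC hL hK₁).pow hw n)
  have h1 := hPR.norm_apply_le' hw i j
  rw [sum_walkMajP_eq δ d h K' L n, Matrix.sum_apply] at h1
  rw [← Real.norm_of_nonneg (Finset.sum_nonneg fun b _ => walkMajP_nonneg δ d h K' L n b i j)]
  exact h1

/-- The majorant family is ENTRYWISE SUMMABLE over all walks when `ρ′ < 1`. [folklore] -/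
theorem summable_decMaj [Fintype B] (hw : WeightHyp κ d) {δ A₀ : ℝ} (hA₀ : 0 ≤ A₀) (K' : Matrix Y Y ℂ)
    (h : B → Y → ℝ) (E : B → Finset Y) (L : B → Matrix Y Y ℂ) (hsupp : ∀ b y, y ∉ E b → h b y = 0)
    (habs : ∀ b y, |h b y| ≤ 1) {M N C_L K₁ : ℝ} (hM : 0 < M) (hLip : ∀ b y y', |h b y - h b y'| ≤ d y y' / M)
    (hN : ∀ y, ((Finset.univ.filter fun b => y ∈ E b).card : ℝ) ≤ N) (hC : 0 ≤ C_L)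
    (hL : ∀ b, WRS (κ + δ) d (L b) C_L) (hK₁ : ∀ i, ∑ j, ‖K' i j‖ * d i j * Real.exp ((κ + δ) * d i j) ≤ K₁)
    (hρ : 2 * N / M * C_L * K₁ < 1) (i j : Y) :
    Summable fun w : Walk B => decMaj A₀ δ d h K' L w i j := by
  have hnn : ∀ w : Walk B, 0 ≤ decMaj A₀ δ d h K' L w i j := fun w =>
    mul_nonneg hA₀ (walkMajP_nonneg δ d h K' L w.1 w.2 i j)
  refine (summable_sigma_of_nonneg hnn).2 ⟨fun n => Summable.of_finite, ?_⟩
  have hρ0 : 0 ≤ 2 * N / M * C_L * K₁ := by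
    have hN0 : 0 ≤ N := le_trans (by positivity) (hN i)
    have hK0 : 0 ≤ K₁ := le_trans (Finset.sum_nonneg fun j _ => by
      exact mul_nonneg (mul_nonneg (norm_nonneg _) (hw.nonneg i j)) (Real.exp_pos _).le) (hK₁ i)
    positivity
  refine Summable.of_nonneg_of_le (fun n => tsum_nonneg fun b => hnn ⟨n, b⟩)
    (fun n => ?_) ((summable_geometric_of_lt_one hρ0 hρ).mul_left (A₀ * (N * C_L)))
  rw [tsum_fintype]
  simp only [decMaj]
  rw [← Finset.mul_sum]
  calc A₀ * ∑ b : Fin (n + 1) → B, walkMajP δ d h K' L n b i j ≤ A₀ * (N * C_L * (2 * N / M * C_L * K₁) ^ n) :=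
        mul_le_mul_of_nonneg_left (sum_walkMajP_apply_le hw K' h E L hsupp habs hM hLip hN hC hL hK₁ n i j) hA₀
    _ = A₀ * (N * C_L) * (2 * N / M * C_L * K₁) ^ n := by ring

/-- **Localised rows of the SUMMED majorant**: `Σ_j (Σ_w decMaj w (i,j))·e^{κd(i,j)} ≤ A₀·N·C_L′·(1 − ρ′)⁻¹`. [folklore] -/
theorem row_majSum_decMaj_le [Fintype B] (hw : WeightHyp κ d) {δ A₀ : ℝ} (hA₀ : 0 ≤ A₀) (K' : Matrix Y Y ℂ)
    (h : B → Y → ℝ) (E : B → Finset Y) (L : B → Matrix Y Y ℂ) (hsupp : ∀ b y, y ∉ E b → h b y = 0)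
    (habs : ∀ b y, |h b y| ≤ 1) {M N C_L K₁ : ℝ} (hM : 0 < M) (hLip : ∀ b y y', |h b y - h b y'| ≤ d y y' / M)
    (hN : ∀ y, ((Finset.univ.filter fun b => y ∈ E b).card : ℝ) ≤ N) (hC : 0 ≤ C_L)
    (hL : ∀ b, WRS (κ + δ) d (L b) C_L) (hK₁ : ∀ i, ∑ j, ‖K' i j‖ * d i j * Real.exp ((κ + δ) * d i j) ≤ K₁)
    (hρ : 2 * N / M * C_L * K₁ < 1) (i : Y) :
    ∑ j, majSum (decMaj A₀ δ d h K' L) i j * Real.exp (κ * d i j) ≤ A₀ * (N * C_L) * (1 - 2 * N / M * C_L * K₁)⁻¹ := by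
  have hnn : ∀ (w : Walk B) (j : Y), 0 ≤ decMaj A₀ δ d h K' L w i j := fun w j =>
    mul_nonneg hA₀ (walkMajP_nonneg δ d h K' L w.1 w.2 i j)
  have hρ0 : 0 ≤ 2 * N / M * C_L * K₁ := by
    have hN0 : 0 ≤ N := le_trans (by positivity) (hN i)
    have hK0 : 0 ≤ K₁ := le_trans (Finset.sum_nonneg fun j _ => by
      exact mul_nonneg (mul_nonneg (norm_nonneg _) (hw.nonneg i j)) (Real.exp_pos _).le) (hK₁ i)
    positivity
  -- the fibre sums, as a function of the order `n`
  set F : ℕ → Y → ℝ := fun n j => ∑ b : Fin (n + 1) → B, decMaj A₀ δ d h K' L ⟨n, b⟩ i j with hF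
  have hFle : ∀ n, ∑ j, F n j * Real.exp (κ * d i j) ≤ A₀ * (N * C_L) * (2 * N / M * C_L * K₁) ^ n := by
    intro n
    have hPR : WRS κ d (headMajPSum δ d h L * stepMajPSum δ d h K' L ^ n) ((N * C_L) * (2 * N / M * C_L * K₁) ^ n) :=
      (wrs_headMajPSum h E L hsupp habs hC hN hL).mul hw
        ((wrs_stepMajPSum hw K' h E L hsupp habs hM hLip hN hC hL hK₁).pow hw n)
    have h1 := hPR i
    calc ∑ j, F n j * Real.exp (κ * d i j)
        = A₀ * wrs κ d (headMajPSum δ d h L * stepMajPSum δ d h K' L ^ n) i := by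
          rw [wrs, Finset.mul_sum]
          refine Finset.sum_congr rfl fun j _ => ?_
          rw [hF, sum_walkMajP_eq δ d h K' L n, Matrix.sum_apply,
            Real.norm_of_nonneg (Finset.sum_nonneg fun b _ => walkMajP_nonneg δ d h K' L n b i j)]
          simp only [decMaj]
          rw [← Finset.mul_sum]
          ring
      _ ≤ A₀ * ((N * C_L) * (2 * N / M * C_L * K₁) ^ n) := mul_le_mul_of_nonneg_left h1 hA₀
      _ = A₀ * (N * C_L) * (2 * N / M * C_L * K₁) ^ n := by ring
  have hsumF : ∀ j, Summable fun n => F n j := by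
    intro j
    have hs := summable_decMaj hw hA₀ K' h E L hsupp habs hM hLip hN hC hL hK₁ hρ i j
    have := ((summable_sigma_of_nonneg fun w => hnn w j).1 hs).2
    refine this.congr fun n => ?_
    rw [tsum_fintype]
  have hmaj : ∀ j, majSum (decMaj A₀ δ d h K' L) i j = ∑' n, F n j := by
    intro j
    rw [majSum, Summable.tsum_sigma (summable_decMaj hw hA₀ K' h E L hsupp habs hM hLip hN hC hL hK₁ hρ i j)]
    exact tsum_congr fun n => tsum_fintype _
  have hgeo : Summable fun n => A₀ * (N * C_L) * (2 * N / M * C_L * K₁) ^ n :=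
    (summable_geometric_of_lt_one hρ0 hρ).mul_left _
  have hrow : Summable fun n => ∑ j, F n j * Real.exp (κ * d i j) :=
    summable_sum fun j _ => (hsumF j).mul_right _
  calc ∑ j, majSum (decMaj A₀ δ d h K' L) i j * Real.exp (κ * d i j)
      = ∑ j, ∑' n, F n j * Real.exp (κ * d i j) := Finset.sum_congr rfl fun j _ => by rw [hmaj j, tsum_mul_right]
    _ = ∑' n, ∑ j, F n j * Real.exp (κ * d i j) :=
        (Summable.tsum_finsetSum fun j _ => (hsumF j).mul_right _).symm
    _ ≤ ∑' n, A₀ * (N * C_L) * (2 * N / M * C_L * K₁) ^ n := Summable.tsum_le_tsum hFle hrow hgeo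
    _ = A₀ * (N * C_L) * (1 - 2 * N / M * C_L * K₁)⁻¹ := by
        rw [tsum_mul_left, tsum_geometric_of_lt_one hρ0 hρ]

/-! ## §4 The `RowData` -/

/-- **THE HAND-OFF.**  Partition data (supports, `|h| ≤ 1`, Lipschitz `1/M`, overlap `N`), local-inverse budget `C_L′` and
first moment `K₁′` AT RATE `κ + κ₁c₁`, smallness `ρ′ := (2N/M)·C_L′·K₁′ < 1`, the tube property in the path currency
(`#dec(b⃗) ≤ c₀ + c₁·pathLen(y)` for every admissible `y`), frozen decoration values `‖τ(Δ)‖ ≤ e^{κ₁}`, `κ₁ ≥ 0`.  Then the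
decorated family with the coordinate `Δ₀` free is ROW DATA on the disc `‖σ‖ < e^{κ₁}` at rate `κ` with majorant
`e^{κ₁c₀}·walkMajP (κ₁c₁)` and constant `e^{κ₁c₀}·N·C_L′·(1 − ρ′)⁻¹` — volume-free, `Δ₀`-free, `τ`-free. [folklore] -/
theorem rowData_decFamily [Fintype B] (hw : WeightHyp κ d) (K' : Matrix Y Y ℂ) (h : B → Y → ℝ) (E : B → Finset Y)
    (L : B → Matrix Y Y ℂ) (hsupp : ∀ b y, y ∉ E b → h b y = 0) (habs : ∀ b y, |h b y| ≤ 1)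
    {M N C_L K₁ κ₁ c₀ c₁ : ℝ} (hM : 0 < M) (hLip : ∀ b y y', |h b y - h b y'| ≤ d y y' / M)
    (hN : ∀ y, ((Finset.univ.filter fun b => y ∈ E b).card : ℝ) ≤ N) (hC : 0 ≤ C_L)
    (hL : ∀ b, WRS (κ + κ₁ * c₁) d (L b) C_L) (hκ₁ : 0 ≤ κ₁) (hc₁ : 0 ≤ c₁)
    (hK₁ : ∀ i, ∑ j, ‖K' i j‖ * d i j * Real.exp ((κ + κ₁ * c₁) * d i j) ≤ K₁) (hρ : 2 * N / M * C_L * K₁ < 1)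
    (dec : (n : ℕ) → (Fin (n + 1) → B) → Finset Δ)
    (htube : ∀ (n : ℕ) (b : Fin (n + 1) → B) (y : Fin (n + 1) → Y), (∀ t, y t ∈ E (b t)) →
      ((dec n b).card : ℝ) ≤ c₀ + c₁ * pathLen d n y)
    (τ : Δ → ℂ) (hτ : ∀ δ, ‖τ δ‖ ≤ Real.exp κ₁) (Δ₀ : Δ) :
    RowData κ d (Real.exp κ₁) (decFamily h K' L dec τ Δ₀) (decMaj (Real.exp (κ₁ * c₀)) (κ₁ * c₁) d h K' L)
      (Real.exp (κ₁ * c₀) * (N * C_L) * (1 - 2 * N / M * C_L * K₁)⁻¹) where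
  ha w i j := by
    simp only [decFamily, Matrix.smul_apply, smul_eq_mul]
    exact (differentiableOn_decCoeffAt τ Δ₀ dec w.1 w.2 _).mul (differentiableOn_const _)
  hm w σ hσ i j := by
    rw [decFamily, Matrix.smul_apply, smul_eq_mul, norm_mul, decMaj]
    refine norm_coeff_mul_walkTerm_le h E hsupp K' L (mul_nonneg hκ₁ hc₁) d hw.nonneg hw.tri (Real.exp_pos _).le
      w.1 w.2 _ (fun y hy => ?_) i j
    have hσ' : ‖σ‖ ≤ Real.exp κ₁ := (mem_ball_zero_iff.1 hσ).le
    refine (norm_decCoeffAt_le hτ Δ₀ dec w.1 w.2 hσ').trans ?_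
    rw [← Real.exp_nat_mul, ← Real.exp_add]
    refine Real.exp_le_exp.2 ?_
    have := mul_le_mul_of_nonneg_left (htube w.1 w.2 y hy) hκ₁
    calc ((dec w.1 w.2).card : ℝ) * κ₁ = κ₁ * (dec w.1 w.2).card := mul_comm _ _
      _ ≤ κ₁ * (c₀ + c₁ * pathLen d w.1 y) := this
      _ = κ₁ * c₀ + κ₁ * c₁ * pathLen d w.1 y := by ring
  hsum i j := summable_decMaj hw (Real.exp_pos _).le K' h E L hsupp habs hM hLip hN hC hL hK₁ hρ i j
  hρ i := row_majSum_decMaj_le hw (Real.exp_pos _).le K' h E L hsupp habs hM hLip hN hC hL hK₁ hρ i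

/-- **THE HAND-OFF FOR THE CONCRETE DECORATION** `tubeDec cellOf E` (all cells met by `⋃_t □̃_{b_t}`) under PACKING
(`P` cells per ball of radius `R ≥ r + D`, `D` = diameter of the `□̃_b`): row data with majorant `e^{κ₁P}·walkMajP (κ₁P/r)`
and constant `e^{κ₁P}·N·C_L′·(1 − ρ′)⁻¹`, budgets at rate `κ + κ₁·(P/r)` — no tube hypothesis left. [folklore] -/
theorem rowData_decFamily_tube [Fintype B] (hw : WeightHyp κ d) (K' : Matrix Y Y ℂ) (h : B → Y → ℝ)
    (E : B → Finset Y) (L : B → Matrix Y Y ℂ) (hsupp : ∀ b y, y ∉ E b → h b y = 0) (habs : ∀ b y, |h b y| ≤ 1)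
    {M N C_L K₁ κ₁ r D R : ℝ} (hM : 0 < M) (hLip : ∀ b y y', |h b y - h b y'| ≤ d y y' / M)
    (hN : ∀ y, ((Finset.univ.filter fun b => y ∈ E b).card : ℝ) ≤ N) (hC : 0 ≤ C_L) (hκ₁ : 0 ≤ κ₁) (hr : 0 < r)
    (hRD : r + D ≤ R) (cellOf : Y → Δ) {P : ℕ}
    (hpack : ∀ a : Y, ∃ S : Finset Δ, S.card ≤ P ∧ ∀ z, d a z ≤ R → cellOf z ∈ S)
    (hdiam : ∀ b, ∀ z ∈ E b, ∀ z' ∈ E b, d z z' ≤ D) (hL : ∀ b, WRS (κ + κ₁ * (P / r)) d (L b) C_L)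
    (hK₁ : ∀ i, ∑ j, ‖K' i j‖ * d i j * Real.exp ((κ + κ₁ * (P / r)) * d i j) ≤ K₁)
    (hρ : 2 * N / M * C_L * K₁ < 1) (τ : Δ → ℂ) (hτ : ∀ δ, ‖τ δ‖ ≤ Real.exp κ₁) (Δ₀ : Δ) :
    RowData κ d (Real.exp κ₁) (decFamily h K' L (tubeDec cellOf E) τ Δ₀)
      (decMaj (Real.exp (κ₁ * P)) (κ₁ * (P / r)) d h K' L)
      (Real.exp (κ₁ * P) * (N * C_L) * (1 - 2 * N / M * C_L * K₁)⁻¹) :=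
  rowData_decFamily hw K' h E L hsupp habs hM hLip hN hC hL hκ₁ (div_nonneg (Nat.cast_nonneg P) hr.le) hK₁ hρ
    (tubeDec cellOf E) (fun n b y hy => by
      calc ((tubeDec cellOf E n b).card : ℝ) ≤ P * (1 + pathLen d n y / r) :=
            card_tubeDec_le d hw.tri hw.zero hw.nonneg hr hRD cellOf hpack E hdiam b y hy
        _ = P + P / r * pathLen d n y := by ring) τ hτ Δ₀

/-! ## §5 At `s ≡ 1` the summed family is the inverse -/

/-- **`termSum (decFamily … 1 Δ₀) 1 = (1 + K′)⁻¹`**: at `τ ≡ 1`, `σ = 1` every coefficient is `1`, the family is the walk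
expansion to all orders, and its sum is `Ptot·(1 − R)⁻¹ = (1 + K′)⁻¹` — entrywise summability from ANY row data of the
family whose disc contains `1` (`κ₁ > 0`), the resummation identity `(1 + K′)·Ptot = 1 − R`, and the entrywise Neumann
series `AnalyticWalkSum216Neumann.hasSum_pow_apply` BY NAME. [folklore] -/
theorem termSum_decFamily_one [Fintype B] (hw : WeightHyp κ d) {K' : Matrix Y Y ℂ} {h : B → Y → ℝ}
    {L : B → Matrix Y Y ℂ} {ρR Rd ρ : ℝ} (hid : (1 + K') * Ptot h L = 1 - Rem h K' L)
    (hRem : WRS κ d (Rem h K' L) ρR) (hρR : ρR < 1) (dec : (n : ℕ) → (Fin (n + 1) → B) → Finset Δ) (Δ₀ : Δ)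
    {m : Walk B → Y → Y → ℝ} (hRD : RowData κ d Rd (decFamily h K' L dec (fun _ => (1 : ℂ)) Δ₀) m ρ)
    (h1 : (1 : ℂ) ∈ ball (0 : ℂ) Rd) :
    termSum (decFamily h K' L dec (fun _ => (1 : ℂ)) Δ₀) 1 = (1 + K')⁻¹ := by
  have hfam : ∀ (w : Walk B) (i j : Y), decFamily h K' L dec (fun _ => (1 : ℂ)) Δ₀ w 1 i j = walkTerm h K' L w.1 w.2 i j := by
    intro w i j
    rw [decFamily, decCoeffAt_one, one_smul]
  ext i j
  rw [termSum, (inv_one_add_eq hw hid hRem hρR).2]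
  -- summability over all walks from the row data at the point `σ = 1`
  have hsum : Summable fun w : Walk B => walkTerm h K' L w.1 w.2 i j :=
    (hRD.summable h1 i j).congr fun w => hfam w i j
  -- the fibres: finite sums `Σ_{b⃗} walkTerm n b⃗ = Ptot·Rⁿ`
  have hfib : ∀ n : ℕ, HasSum (fun b : Fin (n + 1) → B => walkTerm h K' L n b i j) ((Ptot h L * Rem h K' L ^ n) i j) := by
    intro n
    rw [Ptot_mul_Rem_pow, Matrix.sum_apply]
    exact hasSum_fintype _
  -- the orders: the entrywise Neumann series, multiplied by `Ptot` on the left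
  have hord : HasSum (fun n : ℕ => (Ptot h L * Rem h K' L ^ n) i j) ((Ptot h L * (1 - Rem h K' L)⁻¹) i j) := by
    simp only [Matrix.mul_apply]
    exact hasSum_sum fun k _ => (hasSum_pow_apply hw hRem hρR k j).mul_left (Ptot h L i k)
  have htot : HasSum (fun w : Walk B => walkTerm h K' L w.1 w.2 i j) ((Ptot h L * (1 - Rem h K' L)⁻¹) i j) :=
    HasSum.sigma_of_hasSum hord hfib hsum
  rw [show (fun w : Walk B => decFamily h K' L dec (fun _ => (1 : ℂ)) Δ₀ w 1 i j)
      = fun w : Walk B => walkTerm h K' L w.1 w.2 i j from funext fun w => hfam w i j]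
  exact htot.tsum_eq

end Wrs

end

end Summit.QuantumFields.BalabanUV.Beta.UnitLatticeDecoratedRowData
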